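import Literature.NumberTheory.Automorphic.TwistedQuotientLevelPullback
import Literature.NumberTheory.Automorphic.CompletedCohomologyHeckeAlgebraGLnHolds
import Literature.NumberTheory.Automorphic.AshSmithTheoryHeckeLevelProofs
import Literature.NumberTheory.Automorphic.HeckeAlgebra
import HarnessLib

/-!
# Change of level between unramified levels; the finite principal congruence levels `K_f(𝔫)`

Topic `NumberTheory/Automorphic`; namespace `Literature.NumberTheory.Automorphic`.  Theorems
only.

* `ArithmeticQuotient.IsUnramifiedLevel.bijOn_quotientMapOfLE` — for levels `L' ≤ L` BOTH
  unramified at a place (`IsUnramifiedLevel Kᵥ ιᵥ πᵥ ·`), the projection `𝒢 ⧸ L' → 𝒢 ⧸ L` maps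
  `L' ιᵥ(a) L' / L'` bijectively onto `L ιᵥ(a) L / L` (both are `Kᵥ a Kᵥ / Kᵥ`,
  `bijOn_localCoset`); hence (`TwistedQuotient.pullbackMap_heckeEnd_of_isUnramifiedLevel`)
  pull-back of twisted cohomology from level `L` to level `L'` commutes with the Hecke operators
  at that place — the hypothesis of `TwistedQuotientLevelPullback`;
* `Subgroup.finiteIndex_subgroupOf_of_isCompact_isOpen` — an open subgroup of a compact subgroup
  has finite index in it (so `pullbackMap_injective` applies in characteristic `0`);
* for the finite principal congruence level `K_f(𝔫) = ofFinite⁻¹ K(𝔫) ≤ GL_n(𝔸_K^∞)`, `𝔫 ≠ 0`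
  (compact open, `AshSmithTheoryHeckeLevelProofs`): it is unramified at every `w ∤ 𝔫`
  (`isUnramifiedLevel_comap_principalCongruenceLevel`), contains the integral elements trivial
  at the places dividing `𝔫` (`mem_comap_principalCongruenceLevel_of_localComponent`), is
  contained in every open `U` containing the finite part of `K(𝔫)`, and all its double cosets are
  finite (`finite_doubleCosetQuot_of_isCompact_isOpen`).

## References

* G. Shimura, *Introduction to the arithmetic theory of automorphic functions* (1971), Ch. 3,
  Prop. 3.1–3.3 [ShimuraIATAF1971].
-/

noncomputable section

open scoped NumberField
open IsDedekindDomain CategoryTheory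

namespace Literature.NumberTheory.Automorphic

/-! ### Two unramified levels: the double cosets correspond -/

namespace ArithmeticQuotient

namespace IsUnramifiedLevel

variable {𝒢 : Type*} [Group 𝒢] {Gᵥ : Type*} [Group Gᵥ] {Kᵥ : Subgroup Gᵥ} {ιᵥ : Gᵥ →* 𝒢}
  {πᵥ : 𝒢 →* Gᵥ} {L L' : Subgroup 𝒢}

/-- **For two levels `L' ≤ L` unramified at `v`, `𝒢 ⧸ L' → 𝒢 ⧸ L` maps `L' ιᵥ(a) L' / L'`
bijectively onto `L ιᵥ(a) L / L`.** [cite: ShimuraIATAF1971, Ch. 3, Prop. 3.1] -/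
theorem bijOn_quotientMapOfLE (hle : L' ≤ L) (h : IsUnramifiedLevel Kᵥ ιᵥ πᵥ L)
    (h' : IsUnramifiedLevel Kᵥ ιᵥ πᵥ L') (a : Gᵥ) :
    Set.BijOn (Subgroup.quotientMapOfLE hle) (doubleCosetQuot L' (ιᵥ a)) (doubleCosetQuot L (ιᵥ a)) := by
  have hcomp : ∀ o : Gᵥ ⧸ Kᵥ, Subgroup.quotientMapOfLE hle (h'.localCoset o) = h.localCoset o := by
    intro o
    induction o using QuotientGroup.induction_on with
    | H y => rw [h'.localCoset_mk, h.localCoset_mk]; rfl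
  refine ⟨?_, ?_, ?_⟩
  · intro d hd
    obtain ⟨o, ho, rfl⟩ := (h'.bijOn_localCoset a).surjOn hd
    rw [hcomp]
    exact (h.bijOn_localCoset a).mapsTo ho
  · intro d₁ hd₁ d₂ hd₂ he
    obtain ⟨o₁, ho₁, rfl⟩ := (h'.bijOn_localCoset a).surjOn hd₁
    obtain ⟨o₂, ho₂, rfl⟩ := (h'.bijOn_localCoset a).surjOn hd₂
    rw [hcomp, hcomp] at he
    rw [h.localCoset_injective he]
  · intro d hd
    obtain ⟨o, ho, rfl⟩ := (h.bijOn_localCoset a).surjOn hd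
    exact ⟨h'.localCoset o, (h'.bijOn_localCoset a).mapsTo ho, hcomp o⟩

end IsUnramifiedLevel

end ArithmeticQuotient

/-! ### Pull-back of twisted cohomology commutes with Hecke operators at unramified places -/

namespace TwistedQuotient

universe u

variable {k : Type u} [CommRing k] {Γ 𝒢 : Type u} [Group Γ] [Group 𝒢]
variable (ι : Γ →* 𝒢) {L L' : Subgroup 𝒢} {V : Type u} [AddCommGroup V] [Module k V]
  (ρ : Representation k Γ V)
variable {Gᵥ : Type*} [Group Gᵥ] {Kᵥ : Subgroup Gᵥ} {ιᵥ : Gᵥ →* 𝒢} {πᵥ : 𝒢 →* Gᵥ}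

/-- **`pull (T^L_{ιᵥ a} x) = T^{L'}_{ιᵥ a} (pull x)`** for `L' ≤ L` both unramified at `v`.
[cite: ShimuraIATAF1971, Ch. 3, Prop. 3.1] -/
theorem pullbackMap_heckeEnd_of_isUnramifiedLevel (hle : L' ≤ L)
    (h : ArithmeticQuotient.IsUnramifiedLevel Kᵥ ιᵥ πᵥ L)
    (h' : ArithmeticQuotient.IsUnramifiedLevel Kᵥ ιᵥ πᵥ L') (a : Gᵥ)
    (hfin : (ArithmeticQuotient.doubleCosetQuot L (ιᵥ a)).Finite) (q : ℕ) (x : cohomology ι L ρ q) :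
    (pullbackMap ι ρ hle q).hom (heckeEnd ι L ρ (ιᵥ a) q x) =
      heckeEnd ι L' ρ (ιᵥ a) q ((pullbackMap ι ρ hle q).hom x) :=
  pullbackMap_heckeEnd_apply ι ρ hle (ιᵥ a) (h.bijOn_quotientMapOfLE hle h' a) hfin q x

end TwistedQuotient

/-! ### Open subgroups of compact subgroups have finite index -/

/-- **An open subgroup `L'` meets a compact subgroup `L` in a subgroup of finite index of `L`**
(finitely many cosets `x L'` cover the compact `L`). [folklore] -/
theorem Subgroup.finiteIndex_subgroupOf_of_isCompact_isOpen {G : Type*} [Group G]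
    [TopologicalSpace G] [IsTopologicalGroup G] {L L' : Subgroup G}
    (hL : IsCompact (L : Set G)) (hL' : IsOpen (L' : Set G)) : (L'.subgroupOf L).FiniteIndex := by
  classical
  open scoped Pointwise in
  obtain ⟨t, ht⟩ := hL.elim_finite_subcover (fun x : L => (x : G) • (L' : Set G))
    (fun x => hL'.leftCoset _) fun g hg =>
      Set.mem_iUnion.2 ⟨⟨g, hg⟩, (mem_leftCoset_iff _).2 (by rw [inv_mul_cancel]; exact one_mem _)⟩
  refine @Subgroup.finiteIndex_of_finite_quotient _ _ _ (Finite.of_surjective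
    (fun x : t => ((x : L) : L ⧸ L'.subgroupOf L)) fun c => ?_)
  induction c using QuotientGroup.induction_on with
  | H y =>
  obtain ⟨x, hxt, hx⟩ : ∃ x ∈ t, (y : G) ∈ (x : G) • (L' : Set G) := by
    open scoped Pointwise in simpa only [Set.mem_iUnion, exists_prop] using ht y.2
  refine ⟨⟨x, hxt⟩, ?_⟩
  rw [mem_leftCoset_iff] at hx
  change ((x : L) : L ⧸ L'.subgroupOf L) = (y : L ⧸ L'.subgroupOf L)
  rw [QuotientGroup.eq, Subgroup.mem_subgroupOf]
  exact hx

/-- All double cosets of a compact open level are finite. [cite: ShimuraIATAF1971, Ch. 3, Prop. 3.1] -/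
theorem finite_doubleCosetQuot_of_isCompact_isOpen {G : Type*} [Group G] [TopologicalSpace G]
    [IsTopologicalGroup G] (L : Subgroup G) (hL : IsCompact (L : Set G)) (hL' : IsOpen (L : Set G))
    (g : G) : (ArithmeticQuotient.doubleCosetQuot L g).Finite := by
  haveI := isHeckeTriple_top_of_isCompact_isOpen L hL hL'
  exact finite_orbit_quotient L g

/-! ### The finite principal congruence levels `K_f(𝔫)` -/

namespace BigHeckeGLn

variable {n : ℕ} {K : Type} [Field K] [NumberField K]

/-- **`K_f(𝔫)` is unramified at every `w ∤ 𝔫`.** [folklore] -/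
theorem isUnramifiedLevel_comap_principalCongruenceLevel {𝔫 : Ideal (𝓞 K)} (h𝔫 : 𝔫 ≠ 0)
    {w : HeightOneSpectrum (𝓞 K)} (hw : ¬ w.asIdeal ∣ 𝔫) :
    ArithmeticQuotient.IsUnramifiedLevel
      (valuedCongruenceSubgroup (Fin n) (1 : WithZero (Multiplicative ℤ)))
      (ofLocal n K w) (localComponent n K w)
      ((principalCongruenceLevel n K 𝔫).comap (GLn.ofFinite n K)) := by
  refine isUnramifiedLevel_of_le ?_ fun u hu =>
    localComponent_mem_valuedCongruenceSubgroup_one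
      (comap_ofFinite_principalCongruenceLevel_le n K 𝔫 hu) w
  rintro _ ⟨g, hg, rfl⟩
  have hmem : GLn.ofLocal n K w g ∈ principalCongruenceLevel n K 𝔫 :=
    isMaximalAt_principalCongruenceLevel n K w h𝔫 hw ⟨g, hg, rfl⟩
  rw [Subgroup.mem_comap]
  change GLn.ofFinite n K (GLn.sndHom n K (GLn.ofLocal n K w g)) ∈ _
  rwa [GLn.ofFinite_sndHom_of_mem (principalCongruenceLevel_le n K 𝔫 hmem)]

/-- **`K_f(𝔫)` contains the integral elements trivial at the places dividing `𝔫`.** [folklore] -/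
theorem mem_comap_principalCongruenceLevel_of_localComponent {𝔫 : Ideal (𝓞 K)} (h𝔫 : 𝔫 ≠ 0)
    {k : FiniteAdelicGL n K} (hk : k ∈ glFiniteIntegralLevel n K)
    (hkS : ∀ v : HeightOneSpectrum (𝓞 K), v.asIdeal ∣ 𝔫 → localComponent n K v k = 1) :
    k ∈ (principalCongruenceLevel n K 𝔫).comap (GLn.ofFinite n K) := by
  rw [Subgroup.mem_comap]
  refine mem_principalCongruenceLevel_iff.2 ⟨GLn.ofFinite_mem_glIntegralLevel hk, fun v => ?_⟩
  rw [← localComponent_sndHom, GLn.sndHom_ofFinite]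
  by_cases hv : v.asIdeal ∣ 𝔫
  · rw [hkS v hv]
    exact one_mem _
  · rw [idealRadius_eq_one_of_not_dvd h𝔫 hv]
    exact localComponent_mem_valuedCongruenceSubgroup_one hk v

/-- `K_f(𝔫) ≤ U` as soon as `U` contains the finite part of `K(𝔫)`. [folklore] -/
theorem comap_principalCongruenceLevel_le_of_sndHom_mem {𝔫 : Ideal (𝓞 K)}
    {U : Subgroup (FiniteAdelicGL n K)}
    (hU : ∀ g ∈ principalCongruenceLevel n K 𝔫, GLn.sndHom n K g ∈ U) :
    (principalCongruenceLevel n K 𝔫).comap (GLn.ofFinite n K) ≤ U := by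
  intro k hk
  have := hU _ (Subgroup.mem_comap.1 hk)
  rwa [GLn.sndHom_ofFinite] at this

/-- `K_f(𝔫') ≤ K_f(𝔫)` for `𝔫' ≤ 𝔫`. [folklore] -/
theorem comap_principalCongruenceLevel_mono {𝔫 𝔫' : Ideal (𝓞 K)} (h𝔫' : 𝔫' ≠ 0) (hle : 𝔫' ≤ 𝔫) :
    (principalCongruenceLevel n K 𝔫').comap (GLn.ofFinite n K) ≤
      (principalCongruenceLevel n K 𝔫).comap (GLn.ofFinite n K) :=
  Subgroup.comap_mono (principalCongruenceLevel_mono n K h𝔫' hle)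

/-- `H_S · K_f(𝔫) = 𝒢`-input: `K_f(𝔫)` contains the integral elements trivial at any set of places
containing the support of `𝔫`. [folklore] -/
theorem mem_comap_principalCongruenceLevel_of_localComponent' {𝔫 : Ideal (𝓞 K)} (h𝔫 : 𝔫 ≠ 0)
    {S : Set (HeightOneSpectrum (𝓞 K))} (hS : ∀ v : HeightOneSpectrum (𝓞 K), v.asIdeal ∣ 𝔫 → v ∈ S) :
    ∀ k ∈ glFiniteIntegralLevel n K, (∀ v ∈ S, localComponent n K v k = 1) →
      k ∈ (principalCongruenceLevel n K 𝔫).comap (GLn.ofFinite n K) :=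
  fun _ hk hkS => mem_comap_principalCongruenceLevel_of_localComponent h𝔫 hk
    fun v hv => hkS v (hS v hv)

end BigHeckeGLn

end Literature.NumberTheory.Automorphic
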